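import Summits.Ventures.Crystal3D.Theorems.StickyWulffConstantGenericWallFloorStarFarHolds
import HarnessLib

/-!
# Stub closer `stub_starFar` of the registered skeleton 'CoaxialWallLawCertificates' (crux `CoaxialWallLaw`, stmt-Ventures-19481)

HONEST FRAMING. Venture `Summits/Ventures/Crystal3D` (cell `crystal3d-full`); `--supports` the crux `CoaxialWallLaw` (stmt-Ventures-19481,
`route-Ventures-StickyWulffConstant`), registered line 'CoaxialWallLawCertificates' (cf-p1, 2026-08-29T04:21:53Z).  Closes the stub
`stub_starFar : StarPairFar` BY NAME with the tree theorem `StarFar.starPairFar_holds` (computational grade: `Lean.ofReduceBool`), as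
requested by cf-p1 (04:22:11Z) to learn whether the skeleton gate accepts a computational-grade stub closer.  Nothing new is proved.
-/

namespace Summit.Ventures.Crystal3D.Cruxes.CoaxialWallLaw.Certificates

/-- **Stub closer**: `StarPairFar` (tree theorem `StarFar.starPairFar_holds`, computational grade). -/
theorem stub_starFar : Summit.Ventures.Crystal3D.Theorems.StarPairFar :=
  Summit.Ventures.Crystal3D.Theorems.StarFar.starPairFar_holds

end Summit.Ventures.Crystal3D.Cruxes.CoaxialWallLaw.Certificates
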